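import Summits.QuantumFields.YangMills.Theorems.BalabanUVNodesN21LevelLedgerMixture
import Summits.QuantumFields.YangMills.Theorems.BalabanUVNodesN21AtRRec12ConstLayer

/-!
# YM-DAG node N21 (= NE7c) — ROW A′ §3, THE JUNCTION: road I at explicit carriers AT THE RATE HOME (modules 5 ∕ 7 ∕ 10 of this lineage) WITH (M1)-BY-LEVEL
# CROSSED OUT — both `T4ShellMeasureLevels.LevelLedger` binders `hLA`, `hLB` SUPPLIED by module 12a's `levelLedger_of_thresholdMixture` (sharp pushes uniform in the
# threshold, carriers pinned as normalised window averages; lens Card 6), the level constants `D_j = 2κ_j⁻¹ ≤ D̄ := 2κ_min⁻¹` by dag-n21-e's `two_mul_inv_le`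

Track A of `YM-PLAN.md` (cell `pub-ymgap`, HUMAN RULING D-0062), node **N21**; R134 fan-out seat `pub-ymgap-dag-n21-d` (s2 = BY-NAME KNIT at the record), generation 3,
module 12b (ROW A′ of `ym-lens-BalabanUVNodes-nearmiss/LENS-nearmiss.md` v3.0 Card 6, «§3 junction with `shellWeightBound_geometric_of_ne3Layers` ∕ `…_of_rRec₁₂`»;
dag-lead g6 REBALANCE №58).  THEOREMS ONLY: 0 `def`, 0 `sorry`, standard axioms; COUNT-NEUTRAL; `--supports` the K3′ item `SpineGivenEndpointR12` (rev 15,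
stmt-QuantumFields-19908) as a helper.  `N`-generic, NO Theses import (restate-immune).  Imports module 12a `BalabanUVNodesN21LevelLedgerMixture`
(`levelLedger_of_thresholdMixture`; through it dag-n21-e's file 7 `two_mul_inv_le`) and module 10 `BalabanUVNodesN21AtRRec12ConstLayer` (through it modules 5 ∕ 7:
`shellWeightBound_geometric_of_ne3Layers`, `shellWeightBound_geometric_of_rRec₁₂`, `…_constLayer_inEndRegime`).  Restates nothing; cites by name.

WHAT IS PROVED ([folklore] ∕ [bookkeeping]; each ONE application BY NAME).
* §1 `shellWeightBound_geometric_of_ne3Layers_thresholdMixture` — module 5's `shellWeightBound_geometric_of_ne3Layers` (NE7c at explicit carriers from N16's record decl at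
  the rate home's NE3 layers + [dict] + threshold widths) with BOTH level ledgers produced by `levelLedger_of_thresholdMixture`: in place of `hLA`, `hLB`, `hDA`, `hDB` the
  data are, per run, (R), per-slot finite field laws with measurable tested variables, thresholds `θ_j > 0`, admissible widths `κ_min ≤ κ_j < 1`, [dict] constants `M ≥ 0`,
  SHARP piece ∕ weight families with the two pushes at EVERY threshold of each slot's window, and the carriers' pieces ∕ weights PINNED as the normalised window averages;
  `D̄ := 2κ_min⁻¹`.  CONCLUSION unchanged: `∃ C ≥ 0, ShellWeightBound l₀ T A B shA shB (K ↦ C·(θ ∨ ϑ₂)^K)`.  ROAD I AT THE HOME WITH NO (M1) BINDER.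
* §2 `shellWeightBound_geometric_of_rRec₁₂_thresholdMixture` — the same at the Stage-12 rate home, in-edge N16 BY NAME as the K4 stub `S_N16 (RRec₁₂ 𝔯)` (module 7's
  `shellWeightBound_geometric_of_rRec₁₂`).
* §3 `shellWeightBound_geometric_of_rRec₁₂_constLayer_thresholdMixture` — the constant-layer form (module 10 §1: THE END's letters chosen, `InEndRegime` at the layer;
  `∃ ϑ C, 0 < ϑ < 1 ∧ 0 ≤ C ∧ ShellWeightBound …`).

RESIDUAL DISPLAYED INPUTS after this junction (honest list): the SHARP PUSHES per slot and threshold (NODE O's term object at the Stage-12 record, read uniformly over the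
admissible window — located inputs (O-mix-1′∕2∕3′) of the lens), (R) (cover by pieces), admissible widths, live windows (N20), the [dict] clauses (incl. the (0.4)∕(42)
averaging transfer — GAP-STATED of record), threshold widths (node U2), THE END's letters ∕ `InEndRegime`, and the in-edge `N16At` ∕ `S_N16 (RRec₁₂ 𝔯)`.  (M1) for print's
deterministic sharp procedure at FIXED thresholds is UNTOUCHED (W-a species); this is the mixture road — a convex combination of print's sharp procedure over admissible
thresholds, NOT print's construction verbatim.  NE7c NOT PRINTED and NOT PROVED; **N21 NOT discharged**; typed 28∕28, discharged count untouched; one finite four-torus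
programme at fixed `ε` — NOT ℝ⁴, NOT infinite volume, NOT OS, NOT a mass gap, NOT Clay.  No decl below carries a cite tag.
-/

set_option autoImplicit false

noncomputable section

open scoped BigOperators Matrix Matrix.Norms.L2Operator ENNReal
open MeasureTheory Set

namespace Summit.QuantumFields.YangMills.Theorems.N21AtRRec12Mixture

open Literature.MathematicalPhysics.QuantumFieldTheory.Balaban1983to89
open Literature.MathematicalPhysics.QuantumFieldTheory.Balaban1983to89.T4Continuum (T4Family ULoop)
open B7Prop1Explicit B7Prop2Explicit
open T4AveragingDeficitWall (Plane)
open T4IndicatorShell (ShellWeightBound)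
open T4ShellMeasureLevels (LevelLedger LiveWindow)
open Summit.QuantumFields.BalabanUV.T4Continuum
open MinimalActionSandwich (IsMinimiser)
open MinimalActionRate (Regular sfClass)
open MinimalActionRefine (RegularSup)
open AveragingDeficitDualResidual (dualC1 dualC2)
open AveragingDeficitDerivWallProof (wallConst)
open YMDAG.UVSplit
open Summit.QuantumFields.YangMills.BalabanUVNodes.N16Regime (InEndRegime)
open N21AtKeyedRateHome (shellWeightBound_geometric_of_ne3Layers)
open N21AtRRec12 (shellWeightBound_geometric_of_rRec₁₂)
open N21AtRRec12ConstLayer (shellWeightBound_geometric_of_rRec₁₂_constLayer_inEndRegime)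
open N21LevelLedgerMixture (levelLedger_of_thresholdMixture)
open N21MixtureSlotMeasure (two_mul_inv_le)
open Node00 (NE3Objects₁₁ Stage12Params IsDatumOfRecord₁₂C)

variable {N : ℕ} [NeZero N]

/-! ## §0 The mixture data of the two runs (module 12a §2's binders, once per run) -/

section Mixture

variable {ι σA σB : Type*} {XA : ℕ → σA → Type*} {XB : ℕ → σB → Type*} [∀ K s, MeasurableSpace (XA K s)] [∀ K s, MeasurableSpace (XB K s)]
  {l₀ : ℝ} {T : ℕ → Finset ι} {A B shA shB : ℕ → ℝ → ι → ℝ} {SA : ℕ → Finset σA} {SB : ℕ → Finset σB}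
  {pieceA : ℕ → ℝ → σA → ι → ℝ} {pieceB : ℕ → ℝ → σB → ι → ℝ} {lvlA : ℕ → σA → ℕ} {lvlB : ℕ → σB → ℕ}
  {νA : ∀ K : ℕ, ℝ → ∀ s : σA, Measure (XA K s)} {νB : ∀ K : ℕ, ℝ → ∀ s : σB, Measure (XB K s)}
  [∀ K t s, IsFiniteMeasure (νA K t s)] [∀ K t s, IsFiniteMeasure (νB K t s)]
  {wA : ∀ K : ℕ, ℝ → ∀ s : σA, XA K s → ℝ} {wB : ∀ K : ℕ, ℝ → ∀ s : σB, XB K s → ℝ}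
  {θA κA ρA θB κB ρB τA τB : ℕ → ℝ} {MA : ℕ → ℝ → σA → ℝ} {MB : ℕ → ℝ → σB → ℝ}
  {pcA AsA : ∀ K : ℕ, ℝ → ∀ s : σA, ℝ → ι → ℝ} {pcB AsB : ∀ K : ℕ, ℝ → ∀ s : σB, ℝ → ι → ℝ}
  {N₁ : ℕ} {νbar κmin : ℝ}
  -- run A
  (sh_nonnegA : ∀ K t, |t| ≤ l₀ → ∀ τ ∈ T K, 0 ≤ shA K t τ)
  (sh_leA : ∀ K t, |t| ≤ l₀ → ∀ τ ∈ T K, shA K t τ ≤ A K t τ)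
  (coverA : ∀ K t, |t| ≤ l₀ → ∀ τ ∈ T K, shA K t τ ≤ ∑ s ∈ SA K, pieceA K t s τ)
  (hwA : ∀ K t s, Measurable (wA K t s)) (hθA : ∀ j, 0 < θA j) (hκA : ∀ j, 0 < κA j ∧ κA j < 1) (hρA : ∀ j, 0 ≤ ρA j)
  (hMA : ∀ K t, |t| ≤ l₀ → ∀ s ∈ SA K, 0 ≤ MA K t s)
  (hpcA_int : ∀ K t, |t| ≤ l₀ → ∀ s ∈ SA K, ∀ τ ∈ T K,
    IntegrableOn (fun s' => pcA K t s s' τ) (Icc ((1 - κA (lvlA K s)) * θA (lvlA K s)) (θA (lvlA K s))))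
  (hAsA_int : ∀ K t, |t| ≤ l₀ → ∀ s ∈ SA K, ∀ τ ∈ T K,
    IntegrableOn (fun s' => AsA K t s s' τ) (Icc ((1 - κA (lvlA K s)) * θA (lvlA K s)) (θA (lvlA K s))))
  (hpushA : ∀ K t, |t| ≤ l₀ → ∀ s ∈ SA K, ∀ s' ∈ Icc ((1 - κA (lvlA K s)) * θA (lvlA K s)) (θA (lvlA K s)),
    ∑ τ ∈ T K, pcA K t s s' τ ≤ MA K t s * (νA K t s {x | s' * (1 - ρA (lvlA K s)) ≤ wA K t s x ∧ wA K t s x < s'}).toReal)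
  (htotalA : ∀ K t, |t| ≤ l₀ → ∀ s ∈ SA K, ∀ s' ∈ Icc ((1 - κA (lvlA K s)) * θA (lvlA K s)) (θA (lvlA K s)),
    MA K t s * (νA K t s univ).toReal ≤ ∑ τ ∈ T K, AsA K t s s' τ)
  (hpieceMixA : ∀ K t, |t| ≤ l₀ → ∀ s ∈ SA K, ∀ τ ∈ T K, pieceA K t s τ =
    (κA (lvlA K s) * θA (lvlA K s))⁻¹ * ∫ s' in Icc ((1 - κA (lvlA K s)) * θA (lvlA K s)) (θA (lvlA K s)), pcA K t s s' τ)
  (hAMixA : ∀ K t, |t| ≤ l₀ → ∀ s ∈ SA K, ∀ τ ∈ T K, A K t τ =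
    (κA (lvlA K s) * θA (lvlA K s))⁻¹ * ∫ s' in Icc ((1 - κA (lvlA K s)) * θA (lvlA K s)) (θA (lvlA K s)), AsA K t s s' τ)
  -- run B
  (sh_nonnegB : ∀ K t, |t| ≤ l₀ → ∀ τ ∈ T K, 0 ≤ shB K t τ)
  (sh_leB : ∀ K t, |t| ≤ l₀ → ∀ τ ∈ T K, shB K t τ ≤ B K t τ)
  (coverB : ∀ K t, |t| ≤ l₀ → ∀ τ ∈ T K, shB K t τ ≤ ∑ s ∈ SB K, pieceB K t s τ)
  (hwB : ∀ K t s, Measurable (wB K t s)) (hθB : ∀ j, 0 < θB j) (hκB : ∀ j, 0 < κB j ∧ κB j < 1) (hρB : ∀ j, 0 ≤ ρB j)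
  (hMB : ∀ K t, |t| ≤ l₀ → ∀ s ∈ SB K, 0 ≤ MB K t s)
  (hpcB_int : ∀ K t, |t| ≤ l₀ → ∀ s ∈ SB K, ∀ τ ∈ T K,
    IntegrableOn (fun s' => pcB K t s s' τ) (Icc ((1 - κB (lvlB K s)) * θB (lvlB K s)) (θB (lvlB K s))))
  (hAsB_int : ∀ K t, |t| ≤ l₀ → ∀ s ∈ SB K, ∀ τ ∈ T K,
    IntegrableOn (fun s' => AsB K t s s' τ) (Icc ((1 - κB (lvlB K s)) * θB (lvlB K s)) (θB (lvlB K s))))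
  (hpushB : ∀ K t, |t| ≤ l₀ → ∀ s ∈ SB K, ∀ s' ∈ Icc ((1 - κB (lvlB K s)) * θB (lvlB K s)) (θB (lvlB K s)),
    ∑ τ ∈ T K, pcB K t s s' τ ≤ MB K t s * (νB K t s {x | s' * (1 - ρB (lvlB K s)) ≤ wB K t s x ∧ wB K t s x < s'}).toReal)
  (htotalB : ∀ K t, |t| ≤ l₀ → ∀ s ∈ SB K, ∀ s' ∈ Icc ((1 - κB (lvlB K s)) * θB (lvlB K s)) (θB (lvlB K s)),
    MB K t s * (νB K t s univ).toReal ≤ ∑ τ ∈ T K, AsB K t s s' τ)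
  (hpieceMixB : ∀ K t, |t| ≤ l₀ → ∀ s ∈ SB K, ∀ τ ∈ T K, pieceB K t s τ =
    (κB (lvlB K s) * θB (lvlB K s))⁻¹ * ∫ s' in Icc ((1 - κB (lvlB K s)) * θB (lvlB K s)) (θB (lvlB K s)), pcB K t s s' τ)
  (hAMixB : ∀ K t, |t| ≤ l₀ → ∀ s ∈ SB K, ∀ τ ∈ T K, B K t τ =
    (κB (lvlB K s) * θB (lvlB K s))⁻¹ * ∫ s' in Icc ((1 - κB (lvlB K s)) * θB (lvlB K s)) (θB (lvlB K s)), AsB K t s s' τ)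
  -- windows (N20), admissible widths bounded below, threshold widths (node U2's rate)
  (hwinA : LiveWindow SA lvlA N₁ νbar) (hwinB : LiveWindow SB lvlB N₁ νbar)
  (hκmin : 0 < κmin) (hκminA : ∀ j, κmin ≤ κA j) (hκminB : ∀ j, κmin ≤ κB j)
  {c₂ ϑ₂ : ℝ} (hc₂ : 0 ≤ c₂) (h₂ : 0 ≤ ϑ₂) (h₂' : ϑ₂ < 1) (hτA : ∀ j, τA j ≤ c₂ * ϑ₂ ^ j) (hτB : ∀ j, τB j ≤ c₂ * ϑ₂ ^ j)

include sh_nonnegA sh_leA coverA hwA hθA hκA hρA hMA hpcA_int hAsA_int hpushA htotalA hpieceMixA hAMixA sh_nonnegB sh_leB coverB hwB hθB hκB hρB hMB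
  hpcB_int hAsB_int hpushB htotalB hpieceMixB hAMixB hwinA hwinB hκmin hκminA hκminB hc₂ h₂ h₂' hτA hτB

/-! ## §1 At the home's NE3 layers: module 5 with both level ledgers from the mixture -/

/-- **NE7c AT EXPLICIT CARRIERS FROM THE RATE HOME's NE3 LAYERS — (M1)-BY-LEVEL CROSSED OUT.**  Module 5's `shellWeightBound_geometric_of_ne3Layers` (N16's record decl
`h16 : ∀ K, N16At (ne3OfRecord₁₁ F (o K))` at the layers, a family base `θ`, run-length-uniform END letters, `ε′`, `cg`, the two [dict] clauses, threshold widths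
`τ ≤ c₂ϑ₂^j`) with `hLA`, `hLB` := module 12a's `levelLedger_of_thresholdMixture` on §0's mixture data of the two runs and `D̄ := 2κ_min⁻¹` (`two_mul_inv_le`).
CONCLUSION: `∃ C ≥ 0, ShellWeightBound l₀ T A B shA shB (K ↦ C·(θ ∨ ϑ₂)^K)`.  Road I at the home with NO (M1) binder; every other input displayed; NE7c NOT proved;
N21 NOT discharged. [folklore] -/
theorem shellWeightBound_geometric_of_ne3Layers_thresholdMixture {F : T4Family} {o : ℕ → NE3Objects₁₁ N} (h16 : ∀ K, N16At (ne3OfRecord₁₁ F (o K)))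
    {θ γ l₁ Λbar ε' cg : ℝ} (hθ : 0 < θ) (hθ1 : θ < 1) (hθ6 : θ ^ 6 = ((F.L : ℝ))⁻¹)
    (hN : ∀ K, 1 ≤ (o K).Nper) (hb : ∀ K, 0 ≤ (o K).b) (hbs : ∀ K, 512 * (4 + 1) * (4 + 4) * (F.L : ℝ) ^ 2 * (o K).b ≤ 1)
    (hg : ∀ K, 0 ≤ (o K).g) (hC : ∀ K, 0 ≤ (o K).C) (hΛ₂' : ∀ K, 0 < (o K).Λ₂') (hΛbar : ∀ K, (o K).Λ₂' ≤ Λbar) (hγ : 0 < γ)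
    (hγ3 : ∀ K, (o K).C * (wallConst 4 F.L * ((o K).Nper : ℝ) ^ 2 *
      (Real.sqrt (o K).g * dualC2 4 F.L + 2 * (o K).b ^ 2 * dualC1 4 F.L)) ≤ γ ^ 3)
    (hl₁ : 0 < l₁) (hΛl₁ : ∀ K, (o K).Λ₁ ≤ l₁ ^ 3) (hε' : 0 < ε') (hcg : 0 ≤ cg)
    (hdictA : ∀ j, 1 ≤ j → ∀ x : ℝ,
      (∀ (K : ℕ) (V UA UB : B7Prop1Explicit.Site 4 → Fin 4 → (Matrix (Fin N) (Fin N) ℂ)ˣ) (z : B7Prop1Explicit.Site 4) (μ ν : Fin 4) (t : ℝ),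
        V ∈ (o K).dom → IsMinimiser 4 (sfClass 4 F.L (o K).Nper (o K).ε) F.L (o K).Nper j V UA →
        IsMinimiser 4 (sfClass 4 F.L (o K).Nper (o K).ε) F.L (o K).Nper (j + 1) V UB → Regular 4 F.L (o K).Nper (o K).b (o K).g (j + 1) UB →
        ε' * ((F.L : ℝ)⁻¹) ^ (2 * j) ≤ t →
        |‖((hol UA z (plaqWord μ ν) : (Matrix (Fin N) (Fin N) ℂ)ˣ) : Matrix (Fin N) (Fin N) ℂ) - 1‖
            - ‖((hol (rescale F.L (bavg F.L UB)) z (plaqWord μ ν) : (Matrix (Fin N) (Fin N) ℂ)ˣ) : Matrix (Fin N) (Fin N) ℂ) - 1‖| / t ≤ x) →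
      ρA j ≤ x + τA j)
    (hdictB : ∀ j, 1 ≤ j → ∀ x : ℝ,
      (∀ (K : ℕ) (V UA UB : B7Prop1Explicit.Site 4 → Fin 4 → (Matrix (Fin N) (Fin N) ℂ)ˣ) (z : B7Prop1Explicit.Site 4) (π : Plane 4)
        (r₀ : Fin 4 → Fin F.L) (i₀ j₀ : ℕ) (t : ℝ),
        V ∈ (o K).dom → IsMinimiser 4 (sfClass 4 F.L (o K).Nper (o K).ε) F.L (o K).Nper j V UA →
        IsMinimiser 4 (sfClass 4 F.L (o K).Nper (o K).ε) F.L (o K).Nper (j + 1) V UB → Regular 4 F.L (o K).Nper (o K).b (o K).g (j + 1) UB →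
        RegularSup 4 F.L (o K).Nper (o K).b cg (j + 1) UB → i₀ < F.L → j₀ < F.L → ε' * ((F.L : ℝ)⁻¹) ^ (2 * j) ≤ t →
        |‖((hol UA z (plaqWord π.1.1 π.1.2) : (Matrix (Fin N) (Fin N) ℂ)ˣ) : Matrix (Fin N) (Fin N) ℂ) - 1‖
            - (F.L : ℝ) ^ 2 * ‖((hol UB ((F.L : ℤ) • z + boxVec F.L r₀ + (i₀ : ℤ) • e π.1.1 + (j₀ : ℤ) • e π.1.2)
                (plaqWord π.1.1 π.1.2) : (Matrix (Fin N) (Fin N) ℂ)ˣ) : Matrix (Fin N) (Fin N) ℂ) - 1‖| / t ≤ x) →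
      ρB j ≤ x + τB j) :
    ∃ C : ℝ, 0 ≤ C ∧ ShellWeightBound l₀ T A B shA shB fun K => C * max θ ϑ₂ ^ K :=
  shellWeightBound_geometric_of_ne3Layers h16 hθ hθ1 hθ6 hN hb hbs hg hC hΛ₂' hΛbar hγ hγ3 hl₁ hΛl₁ hε' hcg
    (levelLedger_of_thresholdMixture sh_nonnegA sh_leA coverA hwA hθA hκA hρA hMA hpcA_int hAsA_int hpushA htotalA hpieceMixA hAMixA)
    (levelLedger_of_thresholdMixture sh_nonnegB sh_leB coverB hwB hθB hκB hρB hMB hpcB_int hAsB_int hpushB htotalB hpieceMixB hAMixB)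
    hwinA hwinB (fun j => two_mul_inv_le hκmin (hκminA j)) (fun j => two_mul_inv_le hκmin (hκminB j)) hc₂ h₂ h₂' hτA hτB hdictA hdictB

/-! ## §2 At the Stage-12 rate home: in-edge N16 BY NAME as `S_N16 (RRec₁₂ 𝔯)` -/

/-- **NE7c AT EXPLICIT CARRIERS FROM `S_N16 (RRec₁₂ 𝔯)` BY NAME — (M1)-BY-LEVEL CROSSED OUT.**  Module 7's `shellWeightBound_geometric_of_rRec₁₂` (a Stage-12 rate reading
`𝔯`, the K4 stub `S_N16 (RRec₁₂ 𝔯)`, a datum key `h : IsDatumOfRecord₁₂C F N D`, `(g₀, os)`, the reading's NE3 layers with run-length-uniform END letters, the [dict]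
clauses, threshold widths) with both level ledgers from module 12a on §0's mixture data, `D̄ := 2κ_min⁻¹`.  CONCLUSION: `∃ C ≥ 0, ShellWeightBound l₀ T A B shA shB
(K ↦ C·(θ ∨ ϑ₂)^K)`.  CONDITIONAL on every displayed binder; NE7c NOT proved; N21 NOT discharged. [folklore] -/
theorem shellWeightBound_geometric_of_rRec₁₂_thresholdMixture (𝔯 : RateReading₁₂ N) (hS : S_N16 (RRec₁₂ 𝔯)) {F : T4Family} {D : Datum F N}
    (h : IsDatumOfRecord₁₂C F N D) (g₀ : ℕ → ℝ) (os : List (ULoop F))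
    {θ γE l₁ Λbar ε' cg : ℝ} (hθ : 0 < θ) (hθ1 : θ < 1) (hθ6 : θ ^ 6 = ((F.L : ℝ))⁻¹)
    (hN : ∀ K, 1 ≤ ((𝔯.lit F h.params h.provisos g₀ os).ne3 K).Nper) (hb : ∀ K, 0 ≤ ((𝔯.lit F h.params h.provisos g₀ os).ne3 K).b)
    (hbs : ∀ K, 512 * (4 + 1) * (4 + 4) * (F.L : ℝ) ^ 2 * ((𝔯.lit F h.params h.provisos g₀ os).ne3 K).b ≤ 1)
    (hg : ∀ K, 0 ≤ ((𝔯.lit F h.params h.provisos g₀ os).ne3 K).g) (hC : ∀ K, 0 ≤ ((𝔯.lit F h.params h.provisos g₀ os).ne3 K).C)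
    (hΛ₂' : ∀ K, 0 < ((𝔯.lit F h.params h.provisos g₀ os).ne3 K).Λ₂') (hΛbar : ∀ K, ((𝔯.lit F h.params h.provisos g₀ os).ne3 K).Λ₂' ≤ Λbar) (hγE : 0 < γE)
    (hγ3 : ∀ K, ((𝔯.lit F h.params h.provisos g₀ os).ne3 K).C * (wallConst 4 F.L * (((𝔯.lit F h.params h.provisos g₀ os).ne3 K).Nper : ℝ) ^ 2 *
      (Real.sqrt ((𝔯.lit F h.params h.provisos g₀ os).ne3 K).g * dualC2 4 F.L + 2 * ((𝔯.lit F h.params h.provisos g₀ os).ne3 K).b ^ 2 * dualC1 4 F.L)) ≤ γE ^ 3)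
    (hl₁ : 0 < l₁) (hΛl₁ : ∀ K, ((𝔯.lit F h.params h.provisos g₀ os).ne3 K).Λ₁ ≤ l₁ ^ 3) (hε' : 0 < ε') (hcg : 0 ≤ cg)
    (hdictA : ∀ j, 1 ≤ j → ∀ x : ℝ,
      (∀ (K : ℕ) (V UA UB : B7Prop1Explicit.Site 4 → Fin 4 → (Matrix (Fin N) (Fin N) ℂ)ˣ) (z : B7Prop1Explicit.Site 4) (μ ν : Fin 4) (t : ℝ),
        V ∈ ((𝔯.lit F h.params h.provisos g₀ os).ne3 K).dom →
        IsMinimiser 4 (sfClass 4 F.L ((𝔯.lit F h.params h.provisos g₀ os).ne3 K).Nper ((𝔯.lit F h.params h.provisos g₀ os).ne3 K).ε) F.L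
          ((𝔯.lit F h.params h.provisos g₀ os).ne3 K).Nper j V UA →
        IsMinimiser 4 (sfClass 4 F.L ((𝔯.lit F h.params h.provisos g₀ os).ne3 K).Nper ((𝔯.lit F h.params h.provisos g₀ os).ne3 K).ε) F.L
          ((𝔯.lit F h.params h.provisos g₀ os).ne3 K).Nper (j + 1) V UB →
        Regular 4 F.L ((𝔯.lit F h.params h.provisos g₀ os).ne3 K).Nper ((𝔯.lit F h.params h.provisos g₀ os).ne3 K).b
          ((𝔯.lit F h.params h.provisos g₀ os).ne3 K).g (j + 1) UB →
        ε' * ((F.L : ℝ)⁻¹) ^ (2 * j) ≤ t →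
        |‖((hol UA z (plaqWord μ ν) : (Matrix (Fin N) (Fin N) ℂ)ˣ) : Matrix (Fin N) (Fin N) ℂ) - 1‖
            - ‖((hol (rescale F.L (bavg F.L UB)) z (plaqWord μ ν) : (Matrix (Fin N) (Fin N) ℂ)ˣ) : Matrix (Fin N) (Fin N) ℂ) - 1‖| / t ≤ x) →
      ρA j ≤ x + τA j)
    (hdictB : ∀ j, 1 ≤ j → ∀ x : ℝ,
      (∀ (K : ℕ) (V UA UB : B7Prop1Explicit.Site 4 → Fin 4 → (Matrix (Fin N) (Fin N) ℂ)ˣ) (z : B7Prop1Explicit.Site 4) (π : Plane 4)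
        (r₀ : Fin 4 → Fin F.L) (i₀ j₀ : ℕ) (t : ℝ),
        V ∈ ((𝔯.lit F h.params h.provisos g₀ os).ne3 K).dom →
        IsMinimiser 4 (sfClass 4 F.L ((𝔯.lit F h.params h.provisos g₀ os).ne3 K).Nper ((𝔯.lit F h.params h.provisos g₀ os).ne3 K).ε) F.L
          ((𝔯.lit F h.params h.provisos g₀ os).ne3 K).Nper j V UA →
        IsMinimiser 4 (sfClass 4 F.L ((𝔯.lit F h.params h.provisos g₀ os).ne3 K).Nper ((𝔯.lit F h.params h.provisos g₀ os).ne3 K).ε) F.L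
          ((𝔯.lit F h.params h.provisos g₀ os).ne3 K).Nper (j + 1) V UB →
        Regular 4 F.L ((𝔯.lit F h.params h.provisos g₀ os).ne3 K).Nper ((𝔯.lit F h.params h.provisos g₀ os).ne3 K).b
          ((𝔯.lit F h.params h.provisos g₀ os).ne3 K).g (j + 1) UB →
        RegularSup 4 F.L ((𝔯.lit F h.params h.provisos g₀ os).ne3 K).Nper ((𝔯.lit F h.params h.provisos g₀ os).ne3 K).b cg (j + 1) UB →
        i₀ < F.L → j₀ < F.L → ε' * ((F.L : ℝ)⁻¹) ^ (2 * j) ≤ t →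
        |‖((hol UA z (plaqWord π.1.1 π.1.2) : (Matrix (Fin N) (Fin N) ℂ)ˣ) : Matrix (Fin N) (Fin N) ℂ) - 1‖
            - (F.L : ℝ) ^ 2 * ‖((hol UB ((F.L : ℤ) • z + boxVec F.L r₀ + (i₀ : ℤ) • e π.1.1 + (j₀ : ℤ) • e π.1.2)
                (plaqWord π.1.1 π.1.2) : (Matrix (Fin N) (Fin N) ℂ)ˣ) : Matrix (Fin N) (Fin N) ℂ) - 1‖| / t ≤ x) →
      ρB j ≤ x + τB j) :
    ∃ C : ℝ, 0 ≤ C ∧ ShellWeightBound l₀ T A B shA shB fun K => C * max θ ϑ₂ ^ K :=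
  shellWeightBound_geometric_of_rRec₁₂ 𝔯 hS h g₀ os hθ hθ1 hθ6 hN hb hbs hg hC hΛ₂' hΛbar hγE hγ3 hl₁ hΛl₁ hε' hcg
    (levelLedger_of_thresholdMixture sh_nonnegA sh_leA coverA hwA hθA hκA hρA hMA hpcA_int hAsA_int hpushA htotalA hpieceMixA hAMixA)
    (levelLedger_of_thresholdMixture sh_nonnegB sh_leB coverB hwB hθB hκB hρB hMB hpcB_int hAsB_int hpushB htotalB hpieceMixB hAMixB)
    hwinA hwinB (fun j => two_mul_inv_le hκmin (hκminA j)) (fun j => two_mul_inv_le hκmin (hκminB j)) hdictA hdictB hc₂ h₂ h₂' hτA hτB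

/-! ## §3 The constant-layer form (THE END's letters chosen, the proviso at the layer) -/

/-- **THE SAME AT A CONSTANT NE3 LAYER OF THE STAGE-12 HOME — (M1)-BY-LEVEL CROSSED OUT.**  Module 10's `shellWeightBound_geometric_of_rRec₁₂_constLayer_inEndRegime` (a
rate reading with constant NE3 component `o F`, the K4 stub `S_N16 (RRec₁₂ 𝔯)`, a datum key, THE END's proviso `InEndRegime` at the layer, the regularity numeral, `0 < Λ₂′`,
`ε′`, `cg`, the two [dict] clauses at the layer, threshold widths) with both level ledgers from module 12a on §0's mixture data, `D̄ := 2κ_min⁻¹`.  CONCLUSION: `∃ ϑ C,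
0 < ϑ < 1 ∧ 0 ≤ C ∧ ShellWeightBound l₀ T A B shA shB (K ↦ C·ϑ^K)`.  CONDITIONAL on every displayed binder; NE7c NOT proved; N21 NOT discharged. [folklore] -/
theorem shellWeightBound_geometric_of_rRec₁₂_constLayer_thresholdMixture (𝔯 : RateReading₁₂ N) (o : T4Family → NE3Objects₁₁ N)
    (hconst : ∀ (F : T4Family) (θ : Stage12Params F N) (hP : θ.Provisos₁₂ F N) (g₀ : ℕ → ℝ) (os : List (ULoop F)) (k : ℕ),
      (𝔯.lit F θ hP g₀ os).ne3 k = o F)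
    (hS : S_N16 (RRec₁₂ 𝔯)) {F : T4Family} {D : Datum F N} (h : IsDatumOfRecord₁₂C F N D) (hreg : InEndRegime (ne3OfRecord₁₁ F (o F)))
    (hbs : 512 * (4 + 1) * (4 + 4) * (F.L : ℝ) ^ 2 * (o F).b ≤ 1) (hΛ₂' : 0 < (o F).Λ₂') {ε' cg : ℝ} (hε' : 0 < ε') (hcg : 0 ≤ cg)
    (hdictA : ∀ j, 1 ≤ j → ∀ x : ℝ,
      (∀ (V UA UB : B7Prop1Explicit.Site 4 → Fin 4 → (Matrix (Fin N) (Fin N) ℂ)ˣ) (z : B7Prop1Explicit.Site 4) (μ ν : Fin 4) (t : ℝ),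
        V ∈ (o F).dom → IsMinimiser 4 (sfClass 4 F.L (o F).Nper (o F).ε) F.L (o F).Nper j V UA →
        IsMinimiser 4 (sfClass 4 F.L (o F).Nper (o F).ε) F.L (o F).Nper (j + 1) V UB → Regular 4 F.L (o F).Nper (o F).b (o F).g (j + 1) UB →
        ε' * ((F.L : ℝ)⁻¹) ^ (2 * j) ≤ t →
        |‖((hol UA z (plaqWord μ ν) : (Matrix (Fin N) (Fin N) ℂ)ˣ) : Matrix (Fin N) (Fin N) ℂ) - 1‖
            - ‖((hol (rescale F.L (bavg F.L UB)) z (plaqWord μ ν) : (Matrix (Fin N) (Fin N) ℂ)ˣ) : Matrix (Fin N) (Fin N) ℂ) - 1‖| / t ≤ x) →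
      ρA j ≤ x + τA j)
    (hdictB : ∀ j, 1 ≤ j → ∀ x : ℝ,
      (∀ (V UA UB : B7Prop1Explicit.Site 4 → Fin 4 → (Matrix (Fin N) (Fin N) ℂ)ˣ) (z : B7Prop1Explicit.Site 4) (π : Plane 4)
        (r₀ : Fin 4 → Fin F.L) (i₀ j₀ : ℕ) (t : ℝ),
        V ∈ (o F).dom → IsMinimiser 4 (sfClass 4 F.L (o F).Nper (o F).ε) F.L (o F).Nper j V UA →
        IsMinimiser 4 (sfClass 4 F.L (o F).Nper (o F).ε) F.L (o F).Nper (j + 1) V UB → Regular 4 F.L (o F).Nper (o F).b (o F).g (j + 1) UB →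
        RegularSup 4 F.L (o F).Nper (o F).b cg (j + 1) UB → i₀ < F.L → j₀ < F.L → ε' * ((F.L : ℝ)⁻¹) ^ (2 * j) ≤ t →
        |‖((hol UA z (plaqWord π.1.1 π.1.2) : (Matrix (Fin N) (Fin N) ℂ)ˣ) : Matrix (Fin N) (Fin N) ℂ) - 1‖
            - (F.L : ℝ) ^ 2 * ‖((hol UB ((F.L : ℤ) • z + boxVec F.L r₀ + (i₀ : ℤ) • e π.1.1 + (j₀ : ℤ) • e π.1.2)
                (plaqWord π.1.1 π.1.2) : (Matrix (Fin N) (Fin N) ℂ)ˣ) : Matrix (Fin N) (Fin N) ℂ) - 1‖| / t ≤ x) →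
      ρB j ≤ x + τB j) :
    ∃ ϑ C : ℝ, 0 < ϑ ∧ ϑ < 1 ∧ 0 ≤ C ∧ ShellWeightBound l₀ T A B shA shB fun K => C * ϑ ^ K :=
  shellWeightBound_geometric_of_rRec₁₂_constLayer_inEndRegime 𝔯 o hconst hS h hreg hbs hΛ₂' hε' hcg
    (levelLedger_of_thresholdMixture sh_nonnegA sh_leA coverA hwA hθA hκA hρA hMA hpcA_int hAsA_int hpushA htotalA hpieceMixA hAMixA)
    (levelLedger_of_thresholdMixture sh_nonnegB sh_leB coverB hwB hθB hκB hρB hMB hpcB_int hAsB_int hpushB htotalB hpieceMixB hAMixB)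
    hwinA hwinB (fun j => two_mul_inv_le hκmin (hκminA j)) (fun j => two_mul_inv_le hκmin (hκminB j)) hdictA hdictB hc₂ h₂ h₂' hτA hτB

end Mixture

end Summit.QuantumFields.YangMills.Theorems.N21AtRRec12Mixture

end
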